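import Summits.BirchSwinnertonDyer.BirchSwinnertonDyer.Theorems.ManinLocalTwoThreeTVRigidityAssembly
import Summits.BirchSwinnertonDyer.BirchSwinnertonDyer.Theorems.ManinLocalTwoThreeTowerDescent
import Literature.NumberTheory.EllipticCurves.ModularSymbolsPeriodHomology
import Literature.NumberTheory.EllipticCurves.PAdicLFunctionDistributionProofs
import HarnessLib

/-!
# The hypotheses of E-an-142 `TVPatternRigidity` HOLD for modular-symbol data: (P0) (P1) (P2) (EV) (HK) (INV) for
# `g(n, r) = Φ({∞, r/qⁿ}_f − {∞, 0}_f)` — the first half of the paper edge `RigidityImpliesTower` (PROOFS-an-72 §0, (F1)–(F5))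

Summit `BirchSwinnertonDyer`, route `ManinLocalTwoThree` (cell bsd-f2-manin), cruxes C2/C3 (stmt-BirchSwinnertonDyer-22967/22968) through the
tower input E-an-135 ⟸ `RigidityImpliesTower` ∧ E-an-142 (the latter a tree theorem: `tvPatternRigidity_holds`, p676920).  Prover seat
bsd-line-manin23-p1 (C2/C3 LEAD), gen 10.

DATA.  `f ∈ S₂(Γ₀(N))` a newform with rational coefficients (`IsNewform0 f`, `coeffField f = ⊥`), a prime `q ∤ N`, and ANY additive map
`Φ : Λ_f →+ ℤ/p` on the period lattice invariant under complex conjugation (`Φ(z̄) = Φ(z)`; the intended instance is the plus coordinate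
`z ↦ (z + z̄)/Ω⁺ mod p`, possibly rescaled by the inverse of the plus index).  The symbols `S(n, r) := {∞, r/qⁿ}_f − {∞, 0}_f` lie in `Λ_f`
(`symbolDiff_mem`: the cusp `r/qⁿ` is `Γ₀(N)`-equivalent to `0`), and we put `g(n, r) := Φ(S(n, r))`, `c(γ) := Φ({∞, γ∞}_f)` (both as
hypothesis-defined functions, `hg`, `hc`).  PROVED (the standing facts (F1)–(F3), (F5) of PROOFS-an-72 §0 in the binder shape of
`TowerExtension.TVPatternRigidity N q p`):

* `tvData_level0` (P0) `g(0, r) = 0`;  `tvData_period` (P1) `g(n, r + qⁿ) = g(n, r)`;  `tvData_unreduce` (P2) `g(n+1, q r) = g(n, r)`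
  (`{∞, x + 1} = {∞, x}`, `modularSymbol_add_intCast_holds`);
* `tvData_even` (EV) `g(n, −r) = g(n, r)` (`{∞, −x} = conj {∞, x}` for real `f`, `modularSymbol_neg_eq_conj_holds`, and `Φ ∘ conj = Φ`);
* `tvData_hecke` (HK) `Σ_{t<q} g(m+1, r + t qᵐ) = a_q·g(m, r) − g(m−1, r) + Σ_{t<q} g(1, t)` (Hecke on symbols `modularSymbol_heckeT_eq_sum` +
  `T_q f = a_q f` with `a_q ∈ ℤ`, hypothesis `heig`, e.g. from `IsNewform0.heckeT_eq_coeff_smul`);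
* `tvData_inv` (INV) for `γ ∈ SL₂(ℤ)` with `N ∣ γ₂₁` and `γ₂₁ r + γ₂₂ qⁱ = ε qʲ`: `g(j, ε(γ₁₁ r + γ₁₂ qⁱ)) − g(i, r) = c(γ)` (Manin's relation
  `{∞, γx} = {∞, γ∞} + {∞, x}`, `modularSymbol_gamma0_smul_holds`);
* **`tvData_levelLinear_of_tv`** — hence, by E-an-142 (`tvPatternRigidity_holds`): if moreover `q ≥ 5`, `q ∤ p·N`, `p ∤ (q−1)/2`, `p` prime, and
  TV holds from level `s+1` (`g(n, r + q^{n−1}) = g(n, r)` for `n ≥ s+1`, `q ∤ r`), then `g(n, r) = κ'·n` on the integers prime to `q`.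

HONEST FRAMING: this is the «verification of the hypotheses» half of `RigidityImpliesTower`; the other half (E-an-143: level-linearity ⟹
`c|Γ₁(N) = 0` by telescoping along `q`-Farey paths, contradicting `PlusIndexPrimeTo p f`; and TV ⟸ «no unit twist at level n» by the level
duality `towerLevel_unitTwist_iff_plus_not_dvd`) is NOT done here.  E-an-135, C2, C3, Manin's conjecture and BSD are NOT proved by this file.
No definitions, no sorry.
-/

set_option autoImplicit false
set_option linter.dupNamespace false

noncomputable section

open scoped Classical MatrixGroups ModularForm ComplexConjugate

open CongruenceSubgroup Complex Finset Literature.NumberTheory.EllipticCurves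
  Literature.NumberTheory.EllipticCurves.ModularForms
open Summit.BirchSwinnertonDyer.Rank1Residual.ManinAdditive.TowerExtension

namespace Summit.BirchSwinnertonDyer.BirchSwinnertonDyer.Theorems.ManinLocalTwoThree.TVRigidity

variable {N : ℕ} [NeZero N] (f : CuspForm (Gamma0 N) 2) {p q : ℕ}

/-! ### §1. The symbols `S(n, r) = {∞, r/qⁿ} − {∞, 0}` lie in `Λ_f` -/

/-- `{∞, r/qⁿ}_f − {∞, 0}_f ∈ Λ_f` for `q` prime to `N` (the cusp `r/qⁿ` is `Γ₀(N)`-equivalent to `0`). [folklore] -/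
theorem symbolDiff_mem (hq : q.Prime) (hqN : ¬ q ∣ N) (n : ℕ) (r : ℤ) :
    modularSymbol f ((r : ℚ) / (q : ℚ) ^ n) - modularSymbol f 0 ∈ periodLattice f := by
  have hcop : IsCoprime (N : ℤ) ((q ^ n : ℕ) : ℤ) :=
    Nat.isCoprime_iff_coprime.mpr (Nat.Coprime.pow_right n ((Nat.Prime.coprime_iff_not_dvd hq).mpr hqN).symm)
  have h := modularSymbol_intCast_div_sub_zero_mem_periodLattice f hcop r (m := ((q ^ n : ℕ) : ℤ)) dvd_rfl
  have e : ((r : ℚ) / (((q ^ n : ℕ) : ℤ) : ℚ)) = (r : ℚ) / (q : ℚ) ^ n := by push_cast; ring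
  rwa [e] at h

/-! ### §2. (P0), (P1), (P2), (EV) -/

section Data

variable (hq : q.Prime) (hqN : ¬ q ∣ N) (Φ : periodLattice f →+ ZMod p) (g : ℕ → ℤ → ZMod p)
  (hg : ∀ (n : ℕ) (r : ℤ), g n r = Φ ⟨modularSymbol f ((r : ℚ) / (q : ℚ) ^ n) - modularSymbol f 0, symbolDiff_mem f hq hqN n r⟩)

include hg in
/-- Two symbols with equal arguments have equal `g`-values (rewriting under the subtype). [folklore] -/
theorem tvData_congr {n n' : ℕ} {r r' : ℤ} (h : (r : ℚ) / (q : ℚ) ^ n = (r' : ℚ) / (q : ℚ) ^ n') : g n r = g n' r' := by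
  rw [hg, hg]
  congr 1
  exact Subtype.ext (by simp only [h])

include hg in
/-- A translate of the argument by an integer does not change `g` (`{∞, x + k} = {∞, x}`). [folklore] -/
theorem tvData_of_add_int {n n' : ℕ} {r r' : ℤ} (k : ℤ) (h : (r : ℚ) / (q : ℚ) ^ n = (r' : ℚ) / (q : ℚ) ^ n' + k) :
    g n r = g n' r' := by
  rw [hg, hg]
  congr 1
  refine Subtype.ext ?_
  change modularSymbol f _ - modularSymbol f 0 = modularSymbol f _ - modularSymbol f 0
  rw [h, modularSymbol_add_intCast_holds f]

include hg in
/-- **(P0)** `g(0, r) = 0` (`{∞, r} = {∞, 0}` for an integer `r`). [folklore] -/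
theorem tvData_level0 : ∀ r : ℤ, g 0 r = 0 := by
  intro r
  rw [hg]
  have e : (⟨modularSymbol f ((r : ℚ) / (q : ℚ) ^ 0) - modularSymbol f 0, symbolDiff_mem f hq hqN 0 r⟩ : periodLattice f) = 0 := by
    refine Subtype.ext ?_
    have h := modularSymbol_add_intCast_holds f 0 r
    simp only [pow_zero, div_one, AddSubgroup.coe_zero]
    rw [zero_add] at h
    rw [h, sub_self]
  rw [e, map_zero]

include hg in
/-- **(P1)** `g(n, r + qⁿ) = g(n, r)` (`(r + qⁿ)/qⁿ = r/qⁿ + 1`). [folklore] -/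
theorem tvData_period : ∀ (n : ℕ) (r : ℤ), g n (r + (q : ℤ) ^ n) = g n r := by
  intro n r
  have hq0 : (q : ℚ) ^ n ≠ 0 := pow_ne_zero _ (by exact_mod_cast hq.ne_zero)
  exact tvData_of_add_int f hq hqN Φ g hg 1 (by push_cast; field_simp)

include hg in
/-- **(P2)** `g(n+1, q r) = g(n, r)` (non-reduced fractions). [folklore] -/
theorem tvData_unreduce : ∀ (n : ℕ) (r : ℤ), g (n + 1) ((q : ℤ) * r) = g n r := by
  intro n r
  have hq0 : (q : ℚ) ≠ 0 := by exact_mod_cast hq.ne_zero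
  exact tvData_congr f hq hqN Φ g hg (by push_cast; field_simp; ring)

include hg in
/-- **(EV)** `g(n, −r) = g(n, r)` for a newform with rational (hence real) coefficients and a conjugation-invariant `Φ`
(`{∞, −x} = conj {∞, x}`, `{∞, 0}` is real). [cite: CremonaAlgorithms1997, §2.8] -/
theorem tvData_even (hf : IsNewform0 f) (hQ : coeffField f = ⊥)
    (hconj : ∀ (z : ℂ) (hz : z ∈ periodLattice f), Φ ⟨conj z, conj_mem_periodLattice_holds hf hQ hz⟩ = Φ ⟨z, hz⟩) :
    ∀ (n : ℕ) (r : ℤ), g n (-r) = g n r := by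
  intro n r
  have hreal : ∀ m, (cuspCoeff f m).im = 0 := cuspCoeff_im_eq_zero_of_coeffField_eq_bot hQ
  rw [hg, hg, ← hconj _ (symbolDiff_mem f hq hqN n r)]
  congr 1
  refine Subtype.ext ?_
  have h0 : conj (modularSymbol f 0) = modularSymbol f 0 := by
    have := modularSymbol_neg_eq_conj_holds f hreal 0
    rw [neg_zero] at this
    exact this.symm
  have e : ((-r : ℤ) : ℚ) / (q : ℚ) ^ n = -((r : ℚ) / (q : ℚ) ^ n) := by push_cast; ring
  simp only [e, modularSymbol_neg_eq_conj_holds f hreal, map_sub, h0]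

/-! ### §3. (INV): Manin's relation -/

include hg in
/-- **(INV)** for `γ ∈ SL₂(ℤ)` with `N ∣ γ₂₁` and a relation `γ₂₁ r + γ₂₂ qⁱ = ε qʲ` (`ε = ±1`): with `x = r/qⁱ` one has
`γx = ε(γ₁₁ r + γ₁₂ qⁱ)/qʲ`, and Manin's relation `{∞, γx} = {∞, γ∞} + {∞, x}` gives `g(j, ε(γ₁₁ r + γ₁₂ qⁱ)) − g(i, r) = c(γ)` for
`c(γ) = Φ({∞, γ∞}_f)`. [cite: Manin1972, Prop. 1.4 / Thm. 1.6] -/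
theorem tvData_inv (c : SL(2, ℤ) → ZMod p)
    (hc : ∀ (γ : SL(2, ℤ)) (hγ : (N : ℤ) ∣ (γ : Matrix (Fin 2) (Fin 2) ℤ) 1 0),
      c γ = Φ ⟨cuspSymbol f ⟨γ, by rw [Gamma0_mem]; exact (ZMod.intCast_zmod_eq_zero_iff_dvd _ N).mpr hγ⟩,
        cuspSymbol_mem_periodLattice f _⟩) :
    ∀ γ : SL(2, ℤ), (N : ℤ) ∣ (γ : Matrix (Fin 2) (Fin 2) ℤ) 1 0 →
      ∀ (r : ℤ) (i j : ℕ) (ε : ℤˣ),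
        (γ : Matrix (Fin 2) (Fin 2) ℤ) 1 0 * r + (γ : Matrix (Fin 2) (Fin 2) ℤ) 1 1 * (q : ℤ) ^ i = (ε : ℤ) * (q : ℤ) ^ j →
        g j ((ε : ℤ) * ((γ : Matrix (Fin 2) (Fin 2) ℤ) 0 0 * r + (γ : Matrix (Fin 2) (Fin 2) ℤ) 0 1 * (q : ℤ) ^ i)) - g i r = c γ := by
  intro γ hγ r i j ε hrow
  have hq0 : (q : ℚ) ≠ 0 := by exact_mod_cast hq.ne_zero
  have hqi : (q : ℚ) ^ i ≠ 0 := pow_ne_zero _ hq0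
  have hqj : (q : ℚ) ^ j ≠ 0 := pow_ne_zero _ hq0
  have hε2 : ((ε : ℤ) : ℚ) * ((ε : ℤ) : ℚ) = 1 := by exact_mod_cast units_sq_int ε
  set γ₀ : Gamma0 N := ⟨γ, by rw [Gamma0_mem]; exact (ZMod.intCast_zmod_eq_zero_iff_dvd _ N).mpr hγ⟩ with hγ₀
  set x : ℚ := (r : ℚ) / (q : ℚ) ^ i with hx
  have hrowQ : ((γ : Matrix (Fin 2) (Fin 2) ℤ) 1 0 : ℚ) * (r : ℚ) + ((γ : Matrix (Fin 2) (Fin 2) ℤ) 1 1 : ℚ) * (q : ℚ) ^ i =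
      ((ε : ℤ) : ℚ) * (q : ℚ) ^ j := by exact_mod_cast hrow
  have e10 : (((γ₀ : SL(2, ℤ)) 1 0 : ℚ)) = ((γ : Matrix (Fin 2) (Fin 2) ℤ) 1 0 : ℚ) := by simp [hγ₀]
  have e11 : (((γ₀ : SL(2, ℤ)) 1 1 : ℚ)) = ((γ : Matrix (Fin 2) (Fin 2) ℤ) 1 1 : ℚ) := by simp [hγ₀]
  have e00 : (((γ₀ : SL(2, ℤ)) 0 0 : ℚ)) = ((γ : Matrix (Fin 2) (Fin 2) ℤ) 0 0 : ℚ) := by simp [hγ₀]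
  have e01 : (((γ₀ : SL(2, ℤ)) 0 1 : ℚ)) = ((γ : Matrix (Fin 2) (Fin 2) ℤ) 0 1 : ℚ) := by simp [hγ₀]
  have hden : ((γ₀ : SL(2, ℤ)) 1 0 : ℚ) * x + ((γ₀ : SL(2, ℤ)) 1 1 : ℚ) = ((ε : ℤ) : ℚ) * (q : ℚ) ^ j / (q : ℚ) ^ i := by
    rw [e10, e11, hx, eq_div_iff hqi]
    field_simp
    linear_combination hrowQ
  have hden0 : ((γ₀ : SL(2, ℤ)) 1 0 : ℚ) * x + ((γ₀ : SL(2, ℤ)) 1 1 : ℚ) ≠ 0 := by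
    rw [hden]
    have hε0 : ((ε : ℤ) : ℚ) ≠ 0 := by exact_mod_cast Units.ne_zero ε
    positivity
  have hManin := modularSymbol_gamma0_smul_holds f γ₀ x hden0
  -- the image point
  have hεQ : ((ε : ℤ) : ℚ) = 1 ∨ ((ε : ℤ) : ℚ) = -1 := by
    rcases Int.units_eq_one_or ε with h | h <;> simp [h]
  have himg : (((γ₀ : SL(2, ℤ)) 0 0 : ℚ) * x + ((γ₀ : SL(2, ℤ)) 0 1 : ℚ)) /
      (((γ₀ : SL(2, ℤ)) 1 0 : ℚ) * x + ((γ₀ : SL(2, ℤ)) 1 1 : ℚ)) =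
      ((((ε : ℤ) * ((γ : Matrix (Fin 2) (Fin 2) ℤ) 0 0 * r + (γ : Matrix (Fin 2) (Fin 2) ℤ) 0 1 * (q : ℤ) ^ i) : ℤ)) : ℚ) /
        (q : ℚ) ^ j := by
    rw [hden, hx, e00, e01]
    push_cast
    rcases hεQ with hε | hε <;> rw [hε] <;> field_simp
  rw [himg] at hManin
  rw [hg, hg, hc γ hγ, ← map_sub]
  congr 1
  refine Subtype.ext ?_
  simp only [AddSubgroup.coe_sub, hManin, ← hx, hγ₀]
  ring

/-! ### §4. (HK): Hecke on symbols -/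

include hg in
/-- **(HK)** the `T_q`-relations: for `m ≥ 0` and `r ∈ ℤ`,
`Σ_{t<q} g(m+1, r + t qᵐ) = a_q·g(m, r) − g(m−1, r) + Σ_{t<q} g(1, t)`, where `T_q f = a_q f` (`a_q ∈ ℤ`), from
`a_q {∞, x} = Σ_{t mod q} {∞, (x+t)/q} + {∞, q x}` (`q ∤ N`) at `x = r/qᵐ` and at `x = 0` (`g(m−1, ·)` read with `0 − 1 = 0`:
for `m = 0` both `{∞, q r} − {∞, 0}` and `g(0, r)` vanish). [cite: CremonaAlgorithms1997, §2.4 (2.4.1)–(2.4.2)] -/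
theorem tvData_hecke [NeZero q] (a : ℤ) (heig : heckeT (Gamma0 N) 2 q f = (a : ℂ) • f) :
    ∀ (m : ℕ) (r : ℤ), ∑ t ∈ range q, g (m + 1) (r + (t : ℤ) * (q : ℤ) ^ m) =
      (a : ZMod p) * g m r - g (m - 1) r + ∑ t ∈ range q, g 1 (t : ℤ) := by
  have hq0 : (q : ℚ) ≠ 0 := by exact_mod_cast hq.ne_zero
  -- Hecke on symbols at a point `x`: `Σ_{j : Fin q} {∞, (x + j)/q} = a {∞, x} − {∞, q x}`
  have hecke : ∀ x : ℚ, ∑ j : Fin q, modularSymbol f ((x + ((j : ℕ) : ℚ)) / q) =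
      (a : ℂ) * modularSymbol f x - modularSymbol f (q * x) := by
    intro x
    have h := modularSymbol_heckeT_eq_sum q f hq x
    rw [if_neg hqN, heig, modularSymbol_const_smul] at h
    simp only [Int.cast_natCast] at h
    linear_combination -h
  intro m r
  -- rewrite every `g`-value through `Φ` and collect inside `Φ`
  have hqm : (q : ℚ) ^ m ≠ 0 := pow_ne_zero _ hq0
  -- the summands at level `m + 1`
  have hsum : ∀ t ∈ range q, g (m + 1) (r + (t : ℤ) * (q : ℤ) ^ m) =
      Φ ⟨modularSymbol f ((((r : ℚ) / (q : ℚ) ^ m) + ((t : ℕ) : ℤ)) / q) - modularSymbol f 0,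
        by
          have e : ((((r : ℚ) / (q : ℚ) ^ m) + ((t : ℕ) : ℤ)) / q) = ((r + (t : ℤ) * (q : ℤ) ^ m : ℤ) : ℚ) / (q : ℚ) ^ (m + 1) := by
            push_cast; field_simp; ring
          rw [e]; exact symbolDiff_mem f hq hqN (m + 1) _⟩ := by
    intro t _
    rw [hg]
    congr 1
    refine Subtype.ext ?_
    simp only
    congr 2
    push_cast; field_simp; ring
  rw [sum_congr rfl hsum, ← map_sum]
  -- the summands at level `1` (the constant `κ`)
  have hsum1 : ∀ t ∈ range q, g 1 (t : ℤ) =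
      Φ ⟨modularSymbol f (((0 : ℚ) + ((t : ℕ) : ℤ)) / q) - modularSymbol f 0,
        by
          have e : (((0 : ℚ) + ((t : ℕ) : ℤ)) / q) = ((t : ℤ) : ℚ) / (q : ℚ) ^ 1 := by push_cast; ring
          rw [e]; exact symbolDiff_mem f hq hqN 1 _⟩ := by
    intro t _
    rw [hg]
    congr 1
    refine Subtype.ext ?_
    simp only
    congr 2
    push_cast; ring
  rw [sum_congr rfl hsum1, ← map_sum, hg m r, hg (m - 1) r]
  rw [← zsmul_eq_mul, ← map_zsmul, ← map_sub, ← map_add]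
  congr 1
  refine Subtype.ext ?_
  simp only [AddSubmonoidClass.coe_finsetSum, AddSubgroup.coe_add, AddSubgroup.coe_sub, AddSubgroupClass.coe_zsmul,
    zsmul_eq_mul, Int.cast_natCast]
  -- now a scalar identity in `ℂ`
  set x : ℚ := (r : ℚ) / (q : ℚ) ^ m with hx
  have hS1 : ∑ t ∈ range q, (modularSymbol f ((x + (t : ℚ)) / q) - modularSymbol f 0) =
      (a : ℂ) * modularSymbol f x - modularSymbol f (q * x) - (q : ℂ) * modularSymbol f 0 := by
    rw [sum_sub_distrib, sum_const, card_range, nsmul_eq_mul,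
      ← Fin.sum_univ_eq_sum_range (fun t : ℕ ↦ modularSymbol f ((x + (t : ℚ)) / q)), hecke]
  have hS2 : ∑ t ∈ range q, (modularSymbol f (((0 : ℚ) + (t : ℚ)) / q) - modularSymbol f 0) =
      (a : ℂ) * modularSymbol f 0 - modularSymbol f (q * 0) - (q : ℂ) * modularSymbol f 0 := by
    rw [sum_sub_distrib, sum_const, card_range, nsmul_eq_mul,
      ← Fin.sum_univ_eq_sum_range (fun t : ℕ ↦ modularSymbol f (((0 : ℚ) + (t : ℚ)) / q)), hecke]
  -- `{∞, q·(r/qᵐ)} − {∞, 0}` is the level-`(m−1)` symbol (both vanish for `m = 0`)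
  have hlow : modularSymbol f (q * x) - modularSymbol f 0 =
      modularSymbol f ((r : ℚ) / (q : ℚ) ^ (m - 1)) - modularSymbol f 0 := by
    rw [hx]
    rcases Nat.eq_zero_or_pos m with rfl | hm
    · simp only [pow_zero, div_one, Nat.zero_sub]
      have h1 := modularSymbol_add_intCast_holds f 0 ((q : ℤ) * r)
      have h2 := modularSymbol_add_intCast_holds f 0 r
      push_cast at h1 h2
      rw [zero_add] at h1 h2
      rw [h1, h2]
    · obtain ⟨m', rfl⟩ := Nat.exists_eq_add_one_of_ne_zero (by omega : m ≠ 0)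
      rw [Nat.add_sub_cancel]
      congr 2
      field_simp
      ring
  have h00 : modularSymbol f ((q : ℚ) * 0) = modularSymbol f 0 := by rw [mul_zero]
  rw [hS1, hS2]
  linear_combination -hlow + h00

end Data

/-! ### §5. E-an-142 applied: level-linearity of the symbol data under TV -/

/-- **Level-linearity of the modular-symbol profile under TV** (E-an-142 applied to the data of §2–§4): for a rational newform `f` on
`Γ₀(N)`, primes `p` and `q ≥ 5` with `q ∤ p·N`, `p ∤ (q−1)/2`, a conjugation-invariant additive `Φ : Λ_f →+ ℤ/p`, and the profile
`g(n, r) = Φ({∞, r/qⁿ} − {∞, 0})`: if `g` satisfies TV from level `s+1` (`g(n, r + q^{n−1}) = g(n, r)` for `n ≥ s+1`, `q ∤ r`), then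
`g(n, r) = κ'·n` for all `n` and all `r` prime to `q`.  (`tvPatternRigidity_holds` fed with `tvData_*`.) -/
theorem tvData_levelLinear_of_tv (hf : IsNewform0 f) (hQ : coeffField f = ⊥) (hp : p.Prime) (hq : q.Prime) (h5 : 5 ≤ q)
    (hqpN : ¬ q ∣ p * N) (hadm : ¬ p ∣ (q - 1) / 2) [NeZero q] (a : ℤ) (heig : heckeT (Gamma0 N) 2 q f = (a : ℂ) • f)
    (Φ : periodLattice f →+ ZMod p)
    (hconj : ∀ (z : ℂ) (hz : z ∈ periodLattice f), Φ ⟨conj z, conj_mem_periodLattice_holds hf hQ hz⟩ = Φ ⟨z, hz⟩)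
    (hqN : ¬ q ∣ N) (g : ℕ → ℤ → ZMod p)
    (hg : ∀ (n : ℕ) (r : ℤ), g n r = Φ ⟨modularSymbol f ((r : ℚ) / (q : ℚ) ^ n) - modularSymbol f 0, symbolDiff_mem f hq hqN n r⟩)
    (s : ℕ) (tv : ∀ (n : ℕ) (r : ℤ), s + 1 ≤ n → IsCoprime r (q : ℤ) → g n (r + (q : ℤ) ^ (n - 1)) = g n r) :
    ∃ κ' : ZMod p, ∀ (n : ℕ) (r : ℤ), IsCoprime r (q : ℤ) → g n r = κ' * (n : ZMod p) := by
  set c : SL(2, ℤ) → ZMod p := fun γ ↦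
    if hγ : (N : ℤ) ∣ (γ : Matrix (Fin 2) (Fin 2) ℤ) 1 0 then
      Φ ⟨cuspSymbol f ⟨γ, by rw [Gamma0_mem]; exact (ZMod.intCast_zmod_eq_zero_iff_dvd _ N).mpr hγ⟩,
        cuspSymbol_mem_periodLattice f _⟩
    else 0 with hcdef
  have hc : ∀ (γ : SL(2, ℤ)) (hγ : (N : ℤ) ∣ (γ : Matrix (Fin 2) (Fin 2) ℤ) 1 0),
      c γ = Φ ⟨cuspSymbol f ⟨γ, by rw [Gamma0_mem]; exact (ZMod.intCast_zmod_eq_zero_iff_dvd _ N).mpr hγ⟩,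
        cuspSymbol_mem_periodLattice f _⟩ := fun γ hγ ↦ by simp only [hcdef, dif_pos hγ]
  exact tvPatternRigidity_holds N q hp hq h5 hqpN hadm (NeZero.pos N) (a : ZMod p) (∑ t ∈ range q, g 1 (t : ℤ)) s g c
    (tvData_level0 f hq hqN Φ g hg) (tvData_period f hq hqN Φ g hg) (tvData_unreduce f hq hqN Φ g hg)
    (tvData_even f hq hqN Φ g hg hf hQ hconj) tv rfl (tvData_hecke f hq hqN Φ g hg a heig) (tvData_inv f hq hqN Φ g hg c hc)

end Summit.BirchSwinnertonDyer.BirchSwinnertonDyer.Theorems.ManinLocalTwoThree.TVRigidity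

end
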